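import Summits.ResolutionOfSingularities.ResolutionOfSingularities.Theorems.FrobeniusLadderFInjectiveMacaulayficationPolynomialAwayDim
import Literature.AlgebraicGeometry.Resolution.BlowupChartTransition
import Mathlib.RingTheory.Algebraic.Basic
import HarnessLib

/-!
# Dimension of the affine blow-up chart `R[I/u]` at its maximal ideals, `R` an affine hypersurface domain
# (crux `FInjectiveMacaulayfication`, line `graded-engine`, §16 helper D2)

Support file for crux stmt-ResolutionOfSingularities-15315 (`FrobeniusLadder.FInjectiveMacaulayfication`), §16 THE GRADED
ENGINE (CRUX-PLAN w45a v3, line `graded-engine`, registered stub G4 `stub_gradedChartClause`; design memo GRADED-ENGINE.md v2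
steps (v)/(vi), lead seat res-L1-w45a-lead-1, typed helper target D2 `dim_blowupAlgebra` of `GradedChartClausePlan.lean`).
[OURS · L1 W4.5a] — elementary dimension bookkeeping, not a statement of any manuscript.

The chart ring `C = R[I/u] ⊆ R[1/u]` of the weighted blow-up of `Spec R`, `R = k[X₀, …, X_m]/(f)` a hypersurface domain and
`u ≠ 0`, is an affine `k`-domain (`Literature…finiteType_blowupAlgebra`) lying between `R` and `R[1/u]`; the latter is
algebraic over `R`, so `trdeg_k C = trdeg_k R` and the dimension theorem for affine domains
(`Literature…exists_ringKrullDim_eq_and_trdeg_eq`, Matsumura Thm. 5.6) gives `dim C = dim R = m`; affine domains are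
equidimensional at closed points (`Literature…ringKrullDim_localization_atPrime_eq_of_isMaximal`).

* `ringKrullDim_blowupAlgebra_eq` — `dim A[I/a] = dim A` for an affine domain `A` over a field and `a ≠ 0` (any ideal `I`);
* `dim_blowupAlgebra` — the typed helper target D2 verbatim.

## References

* H. Matsumura, *Commutative Ring Theory*, CUP 1986, §5 Thm. 5.6 and Ex. 5.1. [Matsumura1987]; folklore.
-/

set_option linter.dupNamespace false

noncomputable section

open Literature.AlgebraicGeometry.Resolution

namespace Summit.ResolutionOfSingularities.ResolutionOfSingularities.Theorems.FInjectiveMacaulayfication.BlowupAlgebraDim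

universe u

/-- **`dim A[I/a] = dim A`** for a domain `A` of finite type over a field `k`, an ideal `I` and `0 ≠ a ∈ A`: the blow-up algebra
`A[I/a] ⊆ A[1/a]` is an affine domain, algebraic over `A` (as a subalgebra of `A[1/a]`), so its transcendence degree over `k`
is that of `A` and the dimension theorem `dim = trdeg` gives equality. [cite: Matsumura1987, §5 Thm. 5.6] -/
theorem ringKrullDim_blowupAlgebra_eq (k : Type u) {A : Type u} [Field k] [CommRing A] [IsDomain A] [Algebra k A]
    [Algebra.FiniteType k A] (I : Ideal A) {a : A} (ha : a ≠ 0) :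
    ringKrullDim (blowupAlgebra I a) = ringKrullDim A := by
  haveI : IsDomain (Localization.Away a) :=
    IsLocalization.isDomain_localization (powers_le_nonZeroDivisors_of_noZeroDivisors ha)
  haveI : IsNoetherianRing A := Algebra.FiniteType.isNoetherianRing k A
  haveI : Algebra.FiniteType A (blowupAlgebra I a) := finiteType_blowupAlgebra I a (IsNoetherian.noetherian I)
  haveI : Algebra.FiniteType k (blowupAlgebra I a) := Algebra.FiniteType.trans (S := A) inferInstance inferInstance
  haveI : FaithfulSMul k A :=
    (faithfulSMul_iff_algebraMap_injective k A).mpr (algebraMap k A).injective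
  have hinjL : Function.Injective (algebraMap A (Localization.Away a)) :=
    IsLocalization.injective (Localization.Away a) (powers_le_nonZeroDivisors_of_noZeroDivisors ha)
  haveI : FaithfulSMul A (blowupAlgebra I a) := (faithfulSMul_iff_algebraMap_injective A _).mpr
    fun x y hxy => hinjL (by simpa using congrArg (Subtype.val : blowupAlgebra I a → Localization.Away a) hxy)
  haveI : Algebra.IsAlgebraic A (Localization.Away a) :=
    IsLocalization.isAlgebraic (Localization.Away a) (Submonoid.powers a)
  haveI : Algebra.IsAlgebraic A (blowupAlgebra I a) :=
    Algebra.IsAlgebraic.of_injective (blowupAlgebra I a).val Subtype.val_injective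
  obtain ⟨n₁, h₁, t₁⟩ := exists_ringKrullDim_eq_and_trdeg_eq k (blowupAlgebra I a)
  obtain ⟨n₂, h₂, t₂⟩ := exists_ringKrullDim_eq_and_trdeg_eq k A
  have ht : Algebra.trdeg k (blowupAlgebra I a) = Algebra.trdeg k A := by
    rw [← trdeg_add_eq k A (A := blowupAlgebra I a), trdeg_eq_zero (R := A) (A := blowupAlgebra I a), add_zero]
  rw [t₁, t₂] at ht
  have h12 : n₁ = n₂ := by exact_mod_cast ht
  rw [h₁, h₂, h12]

/-- **D2 `dim_blowupAlgebra`** (typed helper target of the G4 assembly plan, verbatim): for `R = k[X₀, …, X_m]/(f)` with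
`(f)` prime, `f ≠ 0`, an ideal `I` of `R` and `0 ≠ u ∈ I`, every localisation of the blow-up chart `R[I/u]` at a maximal
ideal has dimension `m`. (`u ∈ I` is part of the typed signature and is not used.) [folklore; Matsumura §5 Thm. 5.6, Ex. 5.1] -/
theorem dim_blowupAlgebra (k : Type) [Field k] (m : ℕ) (f : MvPolynomial (Fin (m + 1)) k)
    (hfprime : (Ideal.span {f}).IsPrime) (hf0 : f ≠ 0) (I : Ideal (MvPolynomial (Fin (m + 1)) k ⧸ Ideal.span {f}))
    (u : MvPolynomial (Fin (m + 1)) k ⧸ Ideal.span {f}) (_huI : u ∈ I) (hu : u ≠ 0)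
    (Q : Ideal (blowupAlgebra I u)) [Q.IsMaximal] :
    ringKrullDim (Localization.AtPrime Q) = m := by
  haveI := hfprime
  haveI : IsDomain (MvPolynomial (Fin (m + 1)) k ⧸ Ideal.span {f}) := Ideal.Quotient.isDomain _
  haveI : IsDomain (Localization.Away u) :=
    IsLocalization.isDomain_localization (powers_le_nonZeroDivisors_of_noZeroDivisors hu)
  haveI : Algebra.FiniteType (MvPolynomial (Fin (m + 1)) k ⧸ Ideal.span {f}) (blowupAlgebra I u) :=
    finiteType_blowupAlgebra I u (IsNoetherian.noetherian I)
  haveI : Algebra.FiniteType k (blowupAlgebra I u) :=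
    Algebra.FiniteType.trans (S := MvPolynomial (Fin (m + 1)) k ⧸ Ideal.span {f}) inferInstance inferInstance
  rw [ringKrullDim_localization_atPrime_eq_of_isMaximal k Q, ringKrullDim_blowupAlgebra_eq k I hu,
    PolynomialAwayDim.ringKrullDim_hypersurface k m f hf0 hfprime]

end Summit.ResolutionOfSingularities.ResolutionOfSingularities.Theorems.FInjectiveMacaulayfication.BlowupAlgebraDim

end
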